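import Summits.QuantumFields.YangMills.Theorems.BalabanUVNodesSpineRates
import Summits.QuantumFields.YangMills.Theorems.BalabanUVNodesN15Knit

/-!
# YM-DAG cluster K4 «SpineRates», the EXISTENCE STUB `S_R00x` AT THE RATE CARRIERS: the stub `YMDAG.UVSplit.S_R00x Rec RRec` of route module 2
# (`BalabanUVNodesSpineRates` p418381) — (W2) readings, closers (every-bare-sequence and carrier-FUNCTION readings), and the located A2 trap: a CONSTANT
# carrier function satisfies `S_R00x` at EVERY record predicate (the existence stub alone has no content; it is fixed only jointly with `S_N14 … S_N22` on the
# same bundle) — the K4 twin of `BalabanUVNodesN27xAtSpineCarriers`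
# (cell `pub-ymgap`, HUMAN RULING D-0062 Track A, seat `pub-ymgap-dag-n27-a` g4; `--supports stmt-QuantumFields-19182`, count-neutral)

THE STUB.  `S_R00x Rec RRec := ∀ F D w, Rec F D w → (B) → END → ForSmallCouplings D (g₀ ↦ ∀ os, ∃ R : RateCarriers N, RRec F D g₀ os R)` — «the rate carriers of
record EXIST under the pins» (the ∃-half of K4; in-edges NODE 00 later stages, N11–N13 for the dressed tower, N02∕N03∕N06 for the paired instances).  K4's hook
`SpineRates Rec (RateInputs RRec)` is `SpineRates_of` from `S_R00x` and the six by-name stubs.  No rate-carrier predicate of record exists in the tree.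

WHAT THIS MODULE IS ([bookkeeping]; 0 `def`, 0 `sorry`).
* §1 READINGS: `s_R00x_iff` (`Iff.rfl`), `s_R00x_mono` (antitone in `Rec`, MONOTONE in `RRec` — the existence stub wants the carrier predicate WEAK, the six
  estimates `S_N14 … S_N22` want it STRONG: `RRec` is pinned from both sides, as `SRec` is on the K5 side), `rateCarriers_at_record` (consumer face).
* §2 CLOSERS: `s_R00x_of_forall` (a bundle of record for EVERY bare sequence and string ⇒ `S_R00x` at every `Rec`, `ForSmallCouplings.of_forall`);
  `s_R00x_of_functionReading` (`RRec` contains the graph of a carrier FUNCTION `Rof F D g₀ os` — the natural shape of a definition of record).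
* §3 GUARDS ∕ LOCATED A2 TRAP: **`s_R00x_fires_on_constant`** (for EVERY `Rec` and EVERY fixed bundle `R₀`, the predicate «`R = R₀`» is inhabited everywhere and
  satisfies `S_R00x`: the existence stub ALONE is junk-satisfiable; its content is fixed only JOINTLY with `S_N14 … S_N22` read on the SAME bundle — e.g. with
  `R₀.ne2` the rate-less family `N15AtSpineCarriers.not_s_N15_of_admits_rateless` refutes `S_N15` of that predicate); `exists_rateCarriers` (the bundle type is
  inhabited at every rank, non-degenerately in its NE2 component: PART 1's Landau-gauge LG family; the prefix types `F`, `Datum F N` are inhabited by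
  `N27xAtSpineCarriers.exists_family_and_datum`, cited); `not_s_R00x_of_admits` (R422 at node level); `s_R00x_of_notB`
  (vacuity source located: the (B) antecedent).

HONEST FRAMING.  Bookkeeping over PARAMETERS; no carrier of Bałaban's is constructed; the constant bundle is a TYPING witness; nothing of Bałaban's asserted;
no node discharged; typed 28∕28, count untouched; one finite four-torus programme at fixed `ε` — NOT ℝ⁴, NOT infinite volume, NOT OS, NOT a mass gap, NOT
Clay.  Restate-immune.  No decl below carries a cite tag.
-/

noncomputable section

open Finset

namespace Summit.QuantumFields.YangMills.Theorems.R00xAtRateCarriers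

open Literature.MathematicalPhysics.QuantumFieldTheory.Balaban1983to89
open Literature.MathematicalPhysics.QuantumFieldTheory.Balaban1983to89.T4Continuum
open Literature.MathematicalPhysics.QuantumFieldTheory.Balaban1983to89.NE2NodeTorus (KnitIndex knitInstance knitOp166 knitSite163 covOpKernels inAll
  rhoDist)
open T4ContinuumYM4Torus (ForSmallCouplings)
open YMDAG.UVSplit (Datum RecordPred RateCarriers RateRecordPred S_R00x)

variable {N : ℕ} [NeZero N]

/-! ## §1 (W2) readings -/

/-- **What `S_R00x Rec RRec` says** (`Iff.rfl`). [bookkeeping] -/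
theorem s_R00x_iff (Rec : RecordPred N) (RRec : RateRecordPred N) :
    S_R00x Rec RRec ↔ ∀ (F : T4Family) (D : Datum F N) (w : DagBinding.WorldP), Rec F D w →
      B16.EndStatementBPrinted D.C → DagBinding.EndpointExistence D.C.toB12 →
        ForSmallCouplings D fun g₀ => ∀ os : List (ULoop F), ∃ R : RateCarriers N, RRec F D g₀ os R :=
  Iff.rfl

/-- **`S_R00x` is antitone in `Rec` and MONOTONE in `RRec`** (the existence stub wants the carrier predicate weak; `S_N14 … S_N22` want it strong).
[bookkeeping] -/
theorem s_R00x_mono {Rec Rec' : RecordPred N} {RRec RRec' : RateRecordPred N}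
    (hle : ∀ (F : T4Family) (D : Datum F N) (w : DagBinding.WorldP), Rec' F D w → Rec F D w)
    (hR : ∀ (F : T4Family) (D : Datum F N) (g₀ : ℕ → ℝ) (os : List (ULoop F)) (R : RateCarriers N), RRec F D g₀ os R → RRec' F D g₀ os R)
    (h : S_R00x Rec RRec) : S_R00x Rec' RRec' :=
  fun F D w hRw hB hEnd => (h F D w (hle F D w hRw) hB hEnd).mono fun g₀ hg os => by
    obtain ⟨R, hRR⟩ := hg os
    exact ⟨R, hR F D g₀ os R hRR⟩

/-- **Consumer face**: at a record pair, under (B) and END, rate carriers of record exist for all small-coupling tuned runs and every string. [bookkeeping] -/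
theorem rateCarriers_at_record {Rec : RecordPred N} {RRec : RateRecordPred N} (h : S_R00x Rec RRec)
    {F : T4Family} {D : Datum F N} {w : DagBinding.WorldP} (hRw : Rec F D w)
    (hB : B16.EndStatementBPrinted D.C) (hEnd : DagBinding.EndpointExistence D.C.toB12) :
    ForSmallCouplings D fun g₀ => ∀ os : List (ULoop F), ∃ R : RateCarriers N, RRec F D g₀ os R :=
  h F D w hRw hB hEnd

/-! ## §2 (W2) closers -/

/-- **`S_R00x` FROM A BUNDLE AT EVERY BARE SEQUENCE** (thresholds trivial). [bookkeeping] -/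
theorem s_R00x_of_forall (Rec : RecordPred N) (RRec : RateRecordPred N)
    (h : ∀ (F : T4Family) (D : Datum F N) (g₀ : ℕ → ℝ) (os : List (ULoop F)), ∃ R : RateCarriers N, RRec F D g₀ os R) :
    S_R00x Rec RRec :=
  fun F D _ _ _ _ => ForSmallCouplings.of_forall fun g₀ os => h F D g₀ os

/-- **`S_R00x` FOR EVERY CARRIER-FUNCTION READING**: a FUNCTION `Rof F D g₀ os` (the rate carriers of the run for the string) whose graph lies in `RRec` gives
`S_R00x Rec RRec` at every `Rec`. [bookkeeping] -/
theorem s_R00x_of_functionReading (Rec : RecordPred N) (RRec : RateRecordPred N)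
    (Rof : ∀ (F : T4Family), Datum F N → (ℕ → ℝ) → List (ULoop F) → RateCarriers N)
    (hR : ∀ (F : T4Family) (D : Datum F N) (g₀ : ℕ → ℝ) (os : List (ULoop F)), RRec F D g₀ os (Rof F D g₀ os)) :
    S_R00x Rec RRec :=
  s_R00x_of_forall Rec RRec fun F D g₀ os => ⟨Rof F D g₀ os, hR F D g₀ os⟩

/-! ## §3 Guards and the located A2 trap -/

omit [NeZero N] in
/-- **The bundle type is inhabited at every rank, non-degenerately in its NE2 component** (PART 1's Landau-gauge LG family on the four-dimensional unit tori;
the other components are fillers of no content). [bookkeeping] -/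
theorem exists_rateCarriers : ∃ R : RateCarriers N,
    R.ne2 = { I := KnitIndex 3 2, c35 := 1, p := 1, pi := knitInstance 3 2, Kop := knitOp166 2 0 1 0 0,
              Ksite := knitSite163 2 0 0, Kunit := covOpKernels 2 0 0, inΛ := inAll 2, unitDist := rhoDist 2 } := by
  refine ⟨{ ne1 := ⟨Empty, ⟨fun q => q.elim, fun q => q.elim, fun q => q.elim⟩, 0⟩
            ne2 := { I := KnitIndex 3 2, c35 := 1, p := 1, pi := knitInstance 3 2, Kop := knitOp166 2 0 1 0 0,
                     Ksite := knitSite163 2 0 0, Kunit := covOpKernels 2 0 0, inΛ := inAll 2, unitDist := rhoDist 2 }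
            ne3 := ⟨1, 1, 1, 0, 0, 0, 0, 0, ∅⟩
            u3 := { C := ⟨Unit, fun _ => 1, fun _ => 0, fun _ => le_rfl, Unit, Unit, fun _ _ => 0, fun _ _ => le_rfl, id⟩,
                    W := Set.univ, γ := 1, κ := 0, EA := fun g _ _ => g 0, EB := fun _ g _ _ => g 0, θ := 0, C₅ := 0,
                    Λ := fun _ _ => 0, C₉ := 0, ω := 0, cr := 0, ρ := 0 } }, rfl⟩

/-- **THE LOCATED A2 TRAP: A CONSTANT CARRIER FUNCTION SATISFIES `S_R00x` AT EVERY RECORD PREDICATE.**  For every `Rec` and every fixed bundle `R₀`, the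
predicate «`R = R₀`» (at every datum, bare sequence and string) is inhabited everywhere and has `S_R00x`.  So the existence stub alone has no content; what gives
K4 content is that the SAME `RRec` feeds `S_N14 … S_N22` (e.g. with a rate-less NE2 component `S_N15` of this predicate is refuted —
`N15AtSpineCarriers.not_s_N15_of_admits_rateless`).  Typing witness, degenerate by design. [bookkeeping] -/
theorem s_R00x_fires_on_constant (Rec : RecordPred N) (R₀ : RateCarriers N) :
    (∀ (F : T4Family) (D : Datum F N) (g₀ : ℕ → ℝ) (os : List (ULoop F)), (fun (_ : T4Family) (_ : Datum F N) (_ : ℕ → ℝ)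
      (_ : List (ULoop F)) (R : RateCarriers N) => R = R₀) F D g₀ os R₀) ∧
      S_R00x Rec fun _ _ _ _ R => R = R₀ :=
  ⟨fun _ _ _ _ => rfl, s_R00x_of_forall Rec _ fun _ _ _ _ => ⟨R₀, rfl⟩⟩

/-- **R422 AT NODE LEVEL**: a record pair at which (B) and END hold but, for no thresholds, all small-coupling tuned runs carry rate bundles of record, refutes
`S_R00x`. [bookkeeping] -/
theorem not_s_R00x_of_admits (Rec : RecordPred N) (RRec : RateRecordPred N)
    (h : ∃ (F : T4Family) (D : Datum F N) (w : DagBinding.WorldP), Rec F D w ∧ B16.EndStatementBPrinted D.C ∧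
      DagBinding.EndpointExistence D.C.toB12 ∧
      ¬ ForSmallCouplings D fun g₀ => ∀ os : List (ULoop F), ∃ R : RateCarriers N, RRec F D g₀ os R) :
    ¬ S_R00x Rec RRec := by
  rintro hS
  obtain ⟨F, D, w, hRw, hB, hEnd, hn⟩ := h
  exact hn (hS F D w hRw hB hEnd)

/-- **VACUITY SOURCE, LOCATED — THE (B) ANTECEDENT**: at a record predicate all of whose data fail (B), `S_R00x` holds with no content. [bookkeeping] -/
theorem s_R00x_of_notB (Rec : RecordPred N) (RRec : RateRecordPred N)
    (h : ∀ (F : T4Family) (D : Datum F N) (w : DagBinding.WorldP), Rec F D w → ¬ B16.EndStatementBPrinted D.C) :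
    S_R00x Rec RRec :=
  fun F D w hRw hB _ => absurd hB (h F D w hRw)

end Summit.QuantumFields.YangMills.Theorems.R00xAtRateCarriers

end
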